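import Mathlib
import Summits.ValiantsHypothesis.ValiantsHypothesis.Theorems.LacunarySymmetroidMatrixDescartesDefiniteMomentsZonesExact
import Summits.ValiantsHypothesis.ValiantsHypothesis.Theorems.LacunarySymmetroidMatrixDescartesDefiniteMomentsBudgetWord

/-!
# `MatrixDescartes` (stmt-ValiantsHypothesis-18050) — the DEFINITE-MOMENTS LAW, zones EXACT VII: THE EXACT BUDGET LAW —
# `V + 1` alternating definite scales and Rayleigh polynomials with at most `V` positive roots counted with multiplicity ⇒
# EXACTLY `V·m` positive roots of `det F` with multiplicity; the intrinsic budget bundle and the sharp sign words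

HONEST FRAMING.  Cell `pub-symmetroid`, seat `val-sym-mdr-p2` (gen 16); helper file `--supports` the crux
`Theses.LacunarySymmetroid.MatrixDescartes`, NO closure claim.  Upgrades gen 14's Theorem B/C (`card_posRoots_le_of_definiteMoments`:
AT MOST `V·m` DISTINCT) and gen 15's budget / word laws (`budget_card_posRoots_le`, `card_posRoots_le_of_wordSharp`) to EXACT
counts with multiplicity, for any letter type and any budget `V` (the `V = K − 1` case is `…ZonesExact`).  A sector law beside
the crux; nothing here bears on the crux in its window, on `stub_twoSided`, on `DoorA26`/`DoorA34`, registers, or `VP ≠ VNP`.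

THEOREMS.  `F(x) = ∑ₗ x^{dₗ} Sₗ`, real symmetric letters over `Fin K`, any exponents.  (1) `card_posRoots_multiset_eq_of_budgetScales`:
scales `0 < a₀ < ⋯ < a_V` with `σ(−1)ʲ F(aⱼ) ≻ 0` and every Rayleigh polynomial `P_v` (`v ≠ 0`) with AT MOST `V` positive roots
COUNTED WITH MULTIPLICITY ⇒ `det F` has EXACTLY `V · card ι` positive roots with multiplicity (`card ι` per gap,
`card_roots_gap_eq_of_budget`; every positive root of multiplicity `dim ker`, `rootMultiplicity_eq_corank_of_budgetScales`).
(2) `card_posRoots_multiset_eq_of_budget`: gen 15's INTRINSIC BUDGET BUNDLE (budget `B ≥ 1` with multiplicity, `≥ B` distinct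
positive roots for `v ≠ 0`, one sign near `0⁺`) ⇒ EXACTLY `B · card ι`.  (3) `card_posRoots_multiset_eq_of_wordSharp`: a
SEMIDEFINITE SIGN WORD with `V ≥ 1` changes all of whose Rayleigh polynomials have `V` positive roots ⇒ EXACTLY `V · card ι`.
[folklore]; axioms standard; no definitions.
-/

-- layout Summits/ValiantsHypothesis/ValiantsHypothesis forces the duplicated namespace component
set_option linter.dupNamespace false

namespace Summit.ValiantsHypothesis.ValiantsHypothesis.Theorems.LacunarySymmetroidMatrixDescartes

open Polynomial Matrix Finset
open scoped BigOperators Topology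

namespace DefiniteMoments

variable {ι : Type} [Fintype ι] [DecidableEq ι] {K : ℕ}

/-! ## §1 Alternating scales with a multiplicity budget -/

section Scales

variable {V : ℕ}

omit [DecidableEq ι] in
/-- Distinct budget from the multiplicity budget. [folklore] -/
theorem distinctBudget_of_budget (d : Fin K → ℕ) (S : Fin K → Matrix ι ι ℝ) (a : Fin (V + 1) → ℝ) (σ : ℝ)
    (hdef : ∀ (j : Fin (V + 1)) (v : ι → ℝ), v ≠ 0 →
      0 < σ * (-1) ^ (j : ℕ) * (v ⬝ᵥ ((∑ k, a j ^ d k • S k) *ᵥ v)))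
    (hB : ∀ v : ι → ℝ, v ≠ 0 →
      Multiset.card (((∑ l, C (v ⬝ᵥ (S l *ᵥ v)) * (X : ℝ[X]) ^ d l)).roots.filter (fun t => 0 < t)) ≤ V)
    (v : ι → ℝ) (hv : v ≠ 0) (T : Finset ℝ) (hT : ∀ r ∈ T, 0 < r ∧ v ⬝ᵥ ((∑ k, r ^ d k • S k) *ᵥ v) = 0) :
    T.card ≤ V := by
  classical
  set P := ∑ l, C (v ⬝ᵥ (S l *ᵥ v)) * (X : ℝ[X]) ^ d l with hP
  have hx₀ : v ⬝ᵥ ((∑ k, a 0 ^ d k • S k) *ᵥ v) ≠ 0 := by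
    intro h; have h0 := hdef 0 v hv; rw [h, mul_zero] at h0; exact lt_irrefl 0 h0
  have hP0 : P ≠ 0 := rayleighPoly_ne_zero d S v hx₀
  have hsub : T ⊆ (P.roots.filter (fun t => 0 < t)).toFinset := by
    intro r hr
    obtain ⟨hr0, hfr⟩ := hT r hr
    rw [Multiset.mem_toFinset, Multiset.mem_filter, mem_roots hP0, IsRoot, hP, eval_rayleighPoly]
    exact ⟨hfr, hr0⟩
  exact le_trans (le_trans (Finset.card_le_card hsub) (Multiset.toFinset_card_le _)) (hB v hv)

omit [DecidableEq ι] in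
/-- `V` distinct gap zeros for every `v ≠ 0`. [folklore] -/
theorem distinct_ge_of_scales (d : Fin K → ℕ) (S : Fin K → Matrix ι ι ℝ) (a : Fin (V + 1) → ℝ) (ha : StrictMono a)
    (ha0 : 0 < a 0) (σ : ℝ)
    (hdef : ∀ (j : Fin (V + 1)) (v : ι → ℝ), v ≠ 0 →
      0 < σ * (-1) ^ (j : ℕ) * (v ⬝ᵥ ((∑ k, a j ^ d k • S k) *ᵥ v))) (v : ι → ℝ) (hv : v ≠ 0) :
    V ≤ (((∑ l, C (v ⬝ᵥ (S l *ᵥ v)) * (X : ℝ[X]) ^ d l)).roots.toFinset.filter (fun t => 0 < t)).card := by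
  classical
  choose z hz1 hz2 hz3 using exists_zero_in_gap d S a ha σ hdef v hv
  have hzinj : Function.Injective z := fun i i' h =>
    gap_eq_of_mem a ha i i' (z i) (hz1 i) (hz2 i) (h ▸ hz1 i') (h ▸ hz2 i')
  have hx₀ : v ⬝ᵥ ((∑ k, a 0 ^ d k • S k) *ᵥ v) ≠ 0 := by
    intro h; have h0 := hdef 0 v hv; rw [h, mul_zero] at h0; exact lt_irrefl 0 h0
  have hP0 := rayleighPoly_ne_zero d S v hx₀
  have hsub : Finset.univ.image z ⊆
      ((∑ l, C (v ⬝ᵥ (S l *ᵥ v)) * (X : ℝ[X]) ^ d l).roots.toFinset.filter (fun t => 0 < t)) := by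
    intro x hx
    obtain ⟨i, -, rfl⟩ := Finset.mem_image.1 hx
    rw [Finset.mem_filter, Multiset.mem_toFinset, mem_roots hP0, IsRoot, eval_rayleighPoly]
    exact ⟨hz3 i, (ha0.trans_le (ha.monotone (Fin.zero_le _))).trans (hz1 i)⟩
  have hcard := Finset.card_le_card hsub
  rw [Finset.card_image_of_injective _ hzinj, Finset.card_univ, Fintype.card_fin] at hcard
  exact hcard

omit [DecidableEq ι] in
/-- **Simple Rayleigh zeros under the budget**: at every positive Rayleigh zero the derivative does not vanish. [folklore] -/
theorem eval_derivative_ne_zero_of_budget (d : Fin K → ℕ) (S : Fin K → Matrix ι ι ℝ) (a : Fin (V + 1) → ℝ)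
    (ha : StrictMono a) (ha0 : 0 < a 0) (σ : ℝ)
    (hdef : ∀ (j : Fin (V + 1)) (v : ι → ℝ), v ≠ 0 →
      0 < σ * (-1) ^ (j : ℕ) * (v ⬝ᵥ ((∑ k, a j ^ d k • S k) *ᵥ v)))
    (hB : ∀ v : ι → ℝ, v ≠ 0 →
      Multiset.card (((∑ l, C (v ⬝ᵥ (S l *ᵥ v)) * (X : ℝ[X]) ^ d l)).roots.filter (fun t => 0 < t)) ≤ V)
    (v : ι → ℝ) (hv : v ≠ 0) {x : ℝ} (hx : 0 < x) (hroot : v ⬝ᵥ ((∑ k, x ^ d k • S k) *ᵥ v) = 0) :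
    (derivative (∑ l, C (v ⬝ᵥ (S l *ᵥ v)) * (X : ℝ[X]) ^ d l)).eval x ≠ 0 := by
  set P := ∑ l, C (v ⬝ᵥ (S l *ᵥ v)) * (X : ℝ[X]) ^ d l with hP
  have hx₀ : v ⬝ᵥ ((∑ k, a 0 ^ d k • S k) *ᵥ v) ≠ 0 := by
    intro h; have h0 := hdef 0 v hv; rw [h, mul_zero] at h0; exact lt_irrefl 0 h0
  have hP0 : P ≠ 0 := rayleighPoly_ne_zero d S v hx₀
  have hsharp : Multiset.card (P.roots.filter (fun t => 0 < t)) ≤ (P.roots.toFinset.filter (fun t => 0 < t)).card :=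
    le_trans (hB v hv) (distinct_ge_of_scales d S a ha ha0 σ hdef v hv)
  have hle : P.rootMultiplicity x ≤ 1 := rootMultiplicity_le_one_of_sharp P hsharp hx
  have hisroot : P.IsRoot x := by rw [IsRoot, hP, eval_rayleighPoly]; exact hroot
  have hge : 0 < P.rootMultiplicity x := (rootMultiplicity_pos hP0).2 hisroot
  have hone : P.rootMultiplicity x = 1 := le_antisymm hle hge
  have h := eval_divByMonic_pow_rootMultiplicity_ne_zero x hP0
  rw [hone, pow_one, Multiplicity.eval_divByMonic_eq_eval_derivative hisroot] at h
  exact h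

/-- **EXACT ROOT COUNT IN EACH GAP under the budget**: `det F` has EXACTLY `card ι` roots in `(aᵢ, aᵢ₊₁)` counted with
multiplicity. [folklore] -/
theorem card_roots_gap_eq_of_budget (d : Fin K → ℕ) (S : Fin K → Matrix ι ι ℝ) (hS : ∀ k, (S k).IsSymm)
    (a : Fin (V + 1) → ℝ) (ha : StrictMono a) (ha0 : 0 < a 0) (σ : ℝ)
    (hdef : ∀ (j : Fin (V + 1)) (v : ι → ℝ), v ≠ 0 →
      0 < σ * (-1) ^ (j : ℕ) * (v ⬝ᵥ ((∑ k, a j ^ d k • S k) *ᵥ v)))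
    (hB : ∀ v : ι → ℝ, v ≠ 0 →
      Multiset.card (((∑ l, C (v ⬝ᵥ (S l *ᵥ v)) * (X : ℝ[X]) ^ d l)).roots.filter (fun t => 0 < t)) ≤ V)
    (i : Fin V) :
    Multiset.card ((Matrix.det (∑ k, ((X : ℝ[X]) ^ d k) • (S k).map C)).roots.filter
        (fun t => a i.castSucc < t ∧ t < a i.succ)) = Fintype.card ι := by
  have hbudget := distinctBudget_of_budget d S a σ hdef hB
  -- ends and one-zero property of the gap
  have hFa : ∀ v : ι → ℝ, v ≠ 0 → 0 < σ * (-1) ^ (i : ℕ) * (v ⬝ᵥ ((∑ k, a i.castSucc ^ d k • S k) *ᵥ v)) := by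
    intro v hv; have h := hdef i.castSucc v hv; rwa [Fin.val_castSucc] at h
  have hFb : ∀ v : ι → ℝ, v ≠ 0 → σ * (-1) ^ (i : ℕ) * (v ⬝ᵥ ((∑ k, a i.succ ^ d k • S k) *ᵥ v)) < 0 := by
    intro v hv
    have h := hdef i.succ v hv
    rw [Fin.val_succ, pow_succ] at h
    have e : σ * ((-1) ^ (i : ℕ) * -1) * (v ⬝ᵥ ((∑ k, a i.succ ^ d k • S k) *ᵥ v))
        = -(σ * (-1) ^ (i : ℕ) * (v ⬝ᵥ ((∑ k, a i.succ ^ d k • S k) *ᵥ v))) := by ring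
    rw [e] at h
    linarith
  have hone : ∀ v : ι → ℝ, v ≠ 0 → ∀ r₁ r₂ : ℝ, a i.castSucc < r₁ → r₁ < a i.succ → a i.castSucc < r₂ →
      r₂ < a i.succ → v ⬝ᵥ ((∑ k, r₁ ^ d k • S k) *ᵥ v) = 0 → v ⬝ᵥ ((∑ k, r₂ ^ d k • S k) *ᵥ v) = 0 →
      r₁ = r₂ := by
    intro v hv r₁ r₂ h1 h1' h2 h2' hf1 hf2
    obtain ⟨z, hz, hall⟩ := gapZeros d S a ha ha0 σ hdef hbudget v hv
    have hpos : ∀ r, a i.castSucc < r → 0 < r := fun r hr => (ha0.trans_le (ha.monotone (Fin.zero_le _))).trans hr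
    obtain ⟨i₁, rfl⟩ := hall r₁ (hpos r₁ h1) hf1
    obtain ⟨i₂, rfl⟩ := hall r₂ (hpos r₂ h2) hf2
    have e₁ : i₁ = i := gap_eq_of_mem a ha i₁ i (z i₁) (hz i₁).1 (hz i₁).2.1 h1 h1'
    have e₂ : i₂ = i := gap_eq_of_mem a ha i₂ i (z i₂) (hz i₂).1 (hz i₂).2.1 h2 h2'
    rw [e₁, e₂]
  refine card_roots_window_eq d S hS (ha (Fin.castSucc_lt_succ)) _ hFa hFb hone fun v hv x hx _ hfx => ?_
  exact eval_derivative_ne_zero_of_budget d S a ha ha0 σ hdef hB v hv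
    ((ha0.trans_le (ha.monotone (Fin.zero_le _))).trans hx) hfx

/-- **Multiplicity = kernel dimension under the budget.** [folklore] -/
theorem rootMultiplicity_eq_corank_of_budgetScales (d : Fin K → ℕ) (S : Fin K → Matrix ι ι ℝ) (hS : ∀ k, (S k).IsSymm)
    (a : Fin (V + 1) → ℝ) (ha : StrictMono a) (ha0 : 0 < a 0) (σ : ℝ)
    (hdef : ∀ (j : Fin (V + 1)) (v : ι → ℝ), v ≠ 0 →
      0 < σ * (-1) ^ (j : ℕ) * (v ⬝ᵥ ((∑ k, a j ^ d k • S k) *ᵥ v)))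
    (hB : ∀ v : ι → ℝ, v ≠ 0 →
      Multiset.card (((∑ l, C (v ⬝ᵥ (S l *ᵥ v)) * (X : ℝ[X]) ^ d l)).roots.filter (fun t => 0 < t)) ≤ V)
    {t : ℝ} (ht : 0 < t) :
    (Matrix.det (∑ k, ((X : ℝ[X]) ^ d k) • (S k).map C)).rootMultiplicity t
      = Fintype.card ι - (∑ k, t ^ d k • S k).rank :=
  (Multiplicity.rootMultiplicity_det_pencil_eq_corank d S hS t fun v hv hv0 =>
    eval_derivative_ne_zero_of_budget d S a ha ha0 σ hdef hB v hv0 ht (by rw [hv, dotProduct_zero])).2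

/-- **THE EXACT BUDGET LAW (scales form).**  `V + 1` alternating definite scales and every Rayleigh polynomial with at most
`V` positive roots counted with multiplicity ⇒ `det F` has EXACTLY `V · card ι` positive roots counted with multiplicity.
[folklore] -/
theorem card_posRoots_multiset_eq_of_budgetScales (d : Fin K → ℕ) (S : Fin K → Matrix ι ι ℝ) (hS : ∀ k, (S k).IsSymm)
    (a : Fin (V + 1) → ℝ) (ha : StrictMono a) (ha0 : 0 < a 0) (σ : ℝ)
    (hdef : ∀ (j : Fin (V + 1)) (v : ι → ℝ), v ≠ 0 →
      0 < σ * (-1) ^ (j : ℕ) * (v ⬝ᵥ ((∑ k, a j ^ d k • S k) *ᵥ v)))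
    (hB : ∀ v : ι → ℝ, v ≠ 0 →
      Multiset.card (((∑ l, C (v ⬝ᵥ (S l *ᵥ v)) * (X : ℝ[X]) ^ d l)).roots.filter (fun t => 0 < t)) ≤ V) :
    Multiset.card ((Matrix.det (∑ k, ((X : ℝ[X]) ^ d k) • (S k).map C)).roots.filter (fun t => 0 < t))
      = V * Fintype.card ι := by
  classical
  set P := Matrix.det (∑ k, ((X : ℝ[X]) ^ d k) • (S k).map C) with hP
  have hbudget := distinctBudget_of_budget d S a σ hdef hB
  have hunion : P.roots.toFinset.filter (fun t => 0 < t)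
      = (Finset.univ : Finset (Fin V)).biUnion
          (fun i => P.roots.toFinset.filter (fun t => a i.castSucc < t ∧ t < a i.succ)) := by
    ext x
    rw [Finset.mem_filter, Finset.mem_biUnion]
    constructor
    · rintro ⟨hxr, hx0⟩
      obtain ⟨i, hi1, hi2⟩ := posRoot_mem_gap d S V a ha ha0 σ hdef hbudget hx0 (det_eval_eq_zero_of_mem d S hxr)
      exact ⟨i, Finset.mem_univ _, Finset.mem_filter.2 ⟨hxr, hi1, hi2⟩⟩
    · rintro ⟨i, -, hx⟩
      obtain ⟨hxr, hi1, -⟩ := Finset.mem_filter.1 hx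
      exact ⟨hxr, (ha0.trans_le (ha.monotone (Fin.zero_le _))).trans hi1⟩
  have hdisj : ((Finset.univ : Finset (Fin V)) : Set (Fin V)).PairwiseDisjoint
      (fun i : Fin V => P.roots.toFinset.filter (fun t => a i.castSucc < t ∧ t < a i.succ)) := by
    intro i _ i' _ hne
    rw [Function.onFun, Finset.disjoint_left]
    intro x hx hx'
    obtain ⟨-, h1, h2⟩ := Finset.mem_filter.1 hx
    obtain ⟨-, h3, h4⟩ := Finset.mem_filter.1 hx'
    exact hne (gap_eq_of_mem a ha i i' x h1 h2 h3 h4)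
  rw [card_filter_eq_sum_count, hunion, Finset.sum_biUnion hdisj]
  have hgap : ∀ i : Fin V, ∑ t ∈ P.roots.toFinset.filter (fun t => a i.castSucc < t ∧ t < a i.succ),
      P.roots.count t = Fintype.card ι := fun i => by
    rw [← card_filter_eq_sum_count]; exact card_roots_gap_eq_of_budget d S hS a ha ha0 σ hdef hB i
  rw [Finset.sum_congr rfl fun i _ => hgap i, Finset.sum_const, Finset.card_univ, Fintype.card_fin, smul_eq_mul]

end Scales

/-! ## §2 The intrinsic budget bundle and the sharp sign words -/

/-- **THE EXACT BUDGET LAW (intrinsic bundle form).**  Gen 15's budget bundle — budget `B ≥ 1` with multiplicity for every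
Rayleigh polynomial, at least `B` distinct positive roots for `v ≠ 0`, one sign `s` near `0⁺` — ⇒ `det F` has EXACTLY
`B · card ι` positive roots counted with multiplicity (gen 15 `budget_card_posRoots_le`: at most `B·card ι` distinct).
[folklore] -/
theorem card_posRoots_multiset_eq_of_budget (d : Fin K → ℕ) (S : Fin K → Matrix ι ι ℝ) (hS : ∀ l, (S l).IsSymm)
    (B : ℕ) (hB1 : 1 ≤ B) (s : ℝ)
    (hB : ∀ u : ι → ℝ, ((∑ l, C (u ⬝ᵥ (S l *ᵥ u)) * (X : ℝ[X]) ^ d l).roots.filter (fun t => 0 < t)).card ≤ B)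
    (hsh : ∀ u : ι → ℝ, u ≠ 0 →
      B ≤ ((∑ l, C (u ⬝ᵥ (S l *ᵥ u)) * (X : ℝ[X]) ^ d l).roots.toFinset.filter (fun t => 0 < t)).card)
    (hs : ∀ u : ι → ℝ, u ≠ 0 → ∃ δ : ℝ, 0 < δ ∧ ∀ x : ℝ, 0 < x → x < δ →
      0 < s * (∑ l, C (u ⬝ᵥ (S l *ᵥ u)) * (X : ℝ[X]) ^ d l).eval x) :
    Multiset.card ((Matrix.det (∑ k, ((X : ℝ[X]) ^ d k) • (S k).map C)).roots.filter (fun t => 0 < t))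
      = B * Fintype.card ι := by
  obtain ⟨a, ha, ha0, hdef⟩ := budget_exists_alternatingScales d S hS B hB1 s hB hsh hs
  exact card_posRoots_multiset_eq_of_budgetScales d S hS a ha ha0 s hdef (fun v _ => hB v)

/-- **THE EXACT WORD LAW.**  A SEMIDEFINITE SIGN WORD (`(−1)^{β(dₗ)} Sₗ ⪰ 0`, `β` monotone, `b₀ ≤ β(dₗ) ≤ b₀ + V`, `V ≥ 1`)
all of whose Rayleigh polynomials (`v ≠ 0`) have `V` positive roots ⇒ `det F` has EXACTLY `V · card ι` positive roots
counted with multiplicity (gen 15 `card_posRoots_le_of_wordSharp`: at most `V·card ι` distinct). [folklore] -/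
theorem card_posRoots_multiset_eq_of_wordSharp (d : Fin K → ℕ) (S : Fin K → Matrix ι ι ℝ) (hS : ∀ l, (S l).IsSymm)
    (β : ℕ → ℕ) (hβ : Monotone β) (hsign : ∀ l, (((-1 : ℝ) ^ β (d l)) • S l).PosSemidef) (b₀ V : ℕ) (hV1 : 1 ≤ V)
    (hlo : ∀ l, b₀ ≤ β (d l)) (hhi : ∀ l, β (d l) ≤ b₀ + V)
    (hV : ∀ u : ι → ℝ, u ≠ 0 →
      V ≤ ((∑ l, C (u ⬝ᵥ (S l *ᵥ u)) * (X : ℝ[X]) ^ d l).roots.toFinset.filter (fun t => 0 < t)).card) :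
    Multiset.card ((Matrix.det (∑ k, ((X : ℝ[X]) ^ d k) • (S k).map C)).roots.filter (fun t => 0 < t))
      = V * Fintype.card ι :=
  card_posRoots_multiset_eq_of_budget d S hS V hV1 ((-1) ^ b₀) (word_budget d S β hβ hsign b₀ V hlo hhi) hV
    (word_sign d S β hβ hsign b₀ V hV1 hlo hhi hV)

end DefiniteMoments

end Summit.ValiantsHypothesis.ValiantsHypothesis.Theorems.LacunarySymmetroidMatrixDescartes
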